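import Summits.KontsevichZagierPeriods.KontsevichZagierPeriods.Theses.TerasomaMultiplication
import Literature.NumberTheory.Transcendental.KZLogCalculusProofs

/-!
# `DasGapTwelve` (stmt-KontsevichZagierPeriods-13215) — negative side, part 1: the constant is load-bearing and unique

Refuter (`cdisprove`) by-products for the crux `DasGapTwelve` of route `TerasomaMultiplication`:
`[∫_(0,1) x^(-11/12)(1-x)^(-3/4)] ~ [∫_(0,1) c₀ x^(-3/4)(1-x)^(-3/4)]`, `c₀ = 2^(-1/4)3^(3/8)√(1+√3)`
(`B(1/12,1/4) = c₀·B(1/4,1/4)`, the smallest Yamamoto–Das gap identity, as a KZ-equivalence).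
The crux itself RESISTS (its two values agree exactly — `Γ(1/12)² = 2^(-1/2)3^(3/4)(1+√3)
Γ(1/4)²Γ(1/3)²/π` is classical — and the value is the only known invariant of `KZ.relations`);
this file records, as theorems needing NO witnesses, what any proof must respect.  Work file:
`Cruxes/DasGapTwelve/Disproof.lean`; part 2 (`Witness.lean`) builds the representations and the
literal `¬` statements; part 3 (`Lattice12.lean`) is the Gamma-monomial lattice certificate.

* kit: the pinned domain `unitIoo = (0,1) ⊂ ℝ¹` (measurable, open, positive measure) and absolute
  convergence of real Beta kernels `t^α(1-t)^β`, `α, β > -1`, on it (from Mathlib's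
  `Complex.betaIntegral_convergent` by taking norms);
* the constant: `c₀^4 = 9 + 6√3` (so `c₀` is a root of `T^8 − 18T^4 − 27`, degree ≤ 8 over `ℚ`),
  `c₀^8 = 189 + 108√3`, `(c₀^8−189)² = 34992`, `189 < c₀^8`, `irrational_c₀`;
* the family `DasGapTwelveScaled c` — the crux with the constant a real parameter (anchor
  `dasGapTwelve_iff_scaled : DasGapTwelve ↔ DasGapTwelveScaled c₀`, `Iff.rfl`; the constant-dropped
  variant is stated inline in part 2, `dasGapTwelve_false_without_constant`);
* LOAD-BEARING: `not_equivalent_without_constant` and `not_equivalent_of_le_one` — for every real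
  `c ≤ 1` NO pinned pair is equivalent (`x^(-3/4) < x^(-11/12)` on `(0,1)` gives
  `value r' = c·∫kernel ≤ ∫kernel < value r`; soundness `KZ.Equivalent.value_eq_holds`): the move
  chain must manufacture the irrational algebraic factor `c₀ > 1`;
* TIGHTNESS: `constant_unique` — at most one real constant makes the scaled pair equivalent (so the
  real root `1.086… = 2^(-1/4)3^(3/8)√(√3−1)` of the companion factor `T^8 + 18T^4 − 27` of
  `(T^8−189)²−34992 = (T^8−18T^4−27)(T^8+18T^4−27)` — same `W² = 34992`, opposite sign of `W`, not a
  Galois conjugate of `c₀` — is out);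
* the sector data: `isAlgebraic_c₀` and `hodge_condition` (the Deligne–Koblitz–Ogus Hodge-type
  condition of `(1/12,1/4 ; 1/4,1/4)`, weight 0, for every `u` coprime to 12) — used in part 2 to
  show the crux is the `N = N' = 1, k = 0` instance of the route's `GammaHodgeSector`.
[Kontsevich–Zagier 2001, §1.2; Deligne 1982 (Hodge cycles on abelian varieties), Thm 7.18 and the
Koblitz–Ogus appendix; Das 2000]
-/

noncomputable section

open MeasureTheory Set
open Literature.NumberTheory.Transcendental

namespace Summit.KontsevichZagierPeriods.TerasomaMultiplication.DasGapTwelveNegative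

open Summit.KontsevichZagierPeriods.KontsevichZagierPeriods.Theses.TerasomaMultiplication (DasGapTwelve GammaHodgeSector)

/-- The open unit interval as a subset of `ℝ¹` (the pinned domain of both representations). [folklore] -/
abbrev unitIoo : Set (Fin 1 → ℝ) := {x | x 0 ∈ Set.Ioo (0:ℝ) 1}

/-- `(0,1) ⊂ ℝ¹` is Lebesgue measurable. [folklore] -/
theorem measurableSet_unitIoo : MeasurableSet unitIoo :=
  measurableSet_Ioo.preimage (measurable_pi_apply 0)

/-- `(0,1) ⊂ ℝ¹` is open. [folklore] -/
theorem isOpen_unitIoo : IsOpen unitIoo := isOpen_Ioo.preimage (continuous_apply 0)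

/-- `(0,1) ⊂ ℝ¹` has positive Lebesgue measure. [folklore] -/
theorem volume_unitIoo_pos : 0 < volume unitIoo := by
  refine isOpen_unitIoo.measure_pos volume ⟨fun _ => 1/2, ?_⟩
  simp only [unitIoo, Set.mem_setOf_eq, Set.mem_Ioo]
  norm_num

/-- Absolute convergence of the real Beta integral on `(0,1)` for exponents `> -1`
(from Mathlib's `Complex.betaIntegral_convergent` by taking norms). [folklore] -/
theorem integrableOn_rpow_mul_rpow_Ioo {α β : ℝ} (hα : -1 < α) (hβ : -1 < β) :
    IntegrableOn (fun t : ℝ => t ^ α * (1 - t) ^ β) (Set.Ioo (0:ℝ) 1) := by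
  have h := Complex.betaIntegral_convergent (u := ((α + 1 : ℝ) : ℂ)) (v := ((β + 1 : ℝ) : ℂ))
    (by simp only [Complex.ofReal_re]; linarith) (by simp only [Complex.ofReal_re]; linarith)
  rw [intervalIntegrable_iff_integrableOn_Ioo_of_le zero_le_one] at h
  have hcont : ContinuousOn (fun t : ℝ => t ^ α * (1 - t) ^ β) (Set.Ioo (0:ℝ) 1) :=
    (continuousOn_id.rpow_const fun t ht => Or.inl ht.1.ne').mul
      ((continuousOn_const.sub continuousOn_id).rpow_const fun t ht => Or.inl (sub_pos.2 ht.2).ne')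
  refine h.norm.mono' (hcont.aestronglyMeasurable measurableSet_Ioo) ?_
  filter_upwards [ae_restrict_mem measurableSet_Ioo] with t ht
  have ht1 : 0 < 1 - t := sub_pos.2 ht.2
  have e1 : (1 : ℂ) - (t : ℂ) = ((1 - t : ℝ) : ℂ) := by push_cast; ring
  rw [e1]
  have hR : ‖(t : ℂ) ^ (((α + 1 : ℝ) : ℂ) - 1) * ((1 - t : ℝ) : ℂ) ^ (((β + 1 : ℝ) : ℂ) - 1)‖ =
      t ^ α * (1 - t) ^ β := by
    rw [norm_mul, Complex.norm_cpow_eq_rpow_re_of_pos ht.1, Complex.norm_cpow_eq_rpow_re_of_pos ht1]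
    simp only [Complex.sub_re, Complex.ofReal_re, Complex.one_re, add_sub_cancel_right]
  rw [hR, Real.norm_eq_abs, abs_of_nonneg (mul_nonneg (Real.rpow_nonneg ht.1.le _)
    (Real.rpow_nonneg ht1.le _))]

/-- The same on `ℝ¹ = Fin 1 → ℝ`. [folklore] -/
theorem integrableOn_rpow_mul_rpow {α β : ℝ} (hα : -1 < α) (hβ : -1 < β) :
    IntegrableOn (fun x : Fin 1 → ℝ => (x 0) ^ α * (1 - x 0) ^ β) unitIoo := by
  have he := volume_preserving_funUnique (Fin 1) ℝ
  have := (he.integrableOn_comp_preimage (MeasurableEquiv.measurableEmbedding _)).mpr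
    (integrableOn_rpow_mul_rpow_Ioo hα hβ)
  exact this

/-- `c₀ = 2^(-1/4) · 3^(3/8) · √(1+√3) = 2.0984921908…` (syntactically the crux's prefix). [folklore] -/
def c₀ : ℝ := (2:ℝ) ^ (-(1:ℝ)/4) * (3:ℝ) ^ ((3:ℝ)/8) * Real.sqrt (1 + Real.sqrt 3)

/-- `0 < c₀`. [folklore] -/
theorem c₀_pos : 0 < c₀ := by unfold c₀; positivity

/-- `c₀^4 = 9 + 6√3`: `(2^(-1/4))^4 · (3^(3/8))^4 · √(1+√3)^4 = (1/2)·3√3·(4+2√3)`.  Hence `c₀` is a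
root of `T^8 - 18T^4 - 27` (degree ≤ 8 over `ℚ`; `9 + 6√3` is not a square in `ℚ(√3)`). [folklore] -/
theorem c₀_pow_four : c₀ ^ 4 = 9 + 6 * Real.sqrt 3 := by
  unfold c₀
  have h2 : ((2:ℝ) ^ (-(1:ℝ)/4)) ^ 4 = 1/2 := by
    rw [← Real.rpow_natCast, ← Real.rpow_mul (by norm_num : (0:ℝ) ≤ 2)]
    rw [show (-(1:ℝ)/4) * ((4:ℕ):ℝ) = ((-1:ℤ):ℝ) by norm_num, Real.rpow_intCast]
    norm_num
  have h3 : ((3:ℝ) ^ ((3:ℝ)/8)) ^ 4 = 3 * Real.sqrt 3 := by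
    rw [← Real.rpow_natCast, ← Real.rpow_mul (by norm_num : (0:ℝ) ≤ 3)]
    rw [show ((3:ℝ)/8) * ((4:ℕ):ℝ) = 1 + 1/2 by norm_num, Real.rpow_add (by norm_num : (0:ℝ) < 3),
      Real.rpow_one, Real.sqrt_eq_rpow]
  have h1 : 0 ≤ 1 + Real.sqrt 3 := by positivity
  have h4 : Real.sqrt (1 + Real.sqrt 3) ^ 4 = 4 + 2 * Real.sqrt 3 := by
    rw [show 4 = 2 * 2 by norm_num, pow_mul, Real.sq_sqrt h1]
    linear_combination Real.sq_sqrt (show (0:ℝ) ≤ 3 by norm_num)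
  rw [mul_pow, mul_pow, h2, h3, h4]
  linear_combination (3:ℝ) * Real.sq_sqrt (show (0:ℝ) ≤ 3 by norm_num)

/-- `c₀^8 = 189 + 108√3 = 27(2+√3)²` (the square of `c₀_pow_four`; so `c₀` is a root of
`T^8 - 18T^4 - 27` and has degree ≤ 8 over `ℚ`). [folklore] -/
theorem c₀_pow_eight : c₀ ^ 8 = 189 + 108 * Real.sqrt 3 := by
  unfold c₀
  have h2 : ((2:ℝ) ^ (-(1:ℝ)/4)) ^ 8 = 1/4 := by
    rw [← Real.rpow_natCast, ← Real.rpow_mul (by norm_num : (0:ℝ) ≤ 2)]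
    rw [show (-(1:ℝ)/4) * ((8:ℕ):ℝ) = ((-2:ℤ):ℝ) by norm_num, Real.rpow_intCast]
    norm_num
  have h3 : ((3:ℝ) ^ ((3:ℝ)/8)) ^ 8 = 27 := by
    rw [← Real.rpow_natCast, ← Real.rpow_mul (by norm_num : (0:ℝ) ≤ 3)]
    rw [show ((3:ℝ)/8) * ((8:ℕ):ℝ) = ((3:ℕ):ℝ) by norm_num, Real.rpow_natCast]
    norm_num
  have h1 : 0 ≤ 1 + Real.sqrt 3 := by positivity
  have hsq : (1 + Real.sqrt 3) ^ 2 = 4 + 2 * Real.sqrt 3 := by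
    linear_combination Real.sq_sqrt (show (0:ℝ) ≤ 3 by norm_num)
  have h4 : Real.sqrt (1 + Real.sqrt 3) ^ 8 = 28 + 16 * Real.sqrt 3 := by
    rw [show 8 = 2 * (2 * 2) by norm_num, pow_mul, Real.sq_sqrt h1, pow_mul, hsq]
    linear_combination (4:ℝ) * Real.sq_sqrt (show (0:ℝ) ≤ 3 by norm_num)
  rw [mul_pow, mul_pow, h2, h3, h4]
  ring

/-- `(c₀^8 - 189)^2 = 34992`: `c₀` is a root of `(T^8-189)^2-34992 = (T^8-18T^4-27)(T^8+18T^4-27)` (on the first factor, by `c₀_pow_four`; the polynomial is reducible, not minimal). [folklore] -/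
theorem c₀_pow_eight_sub_sq : (c₀ ^ 8 - 189) ^ 2 = 34992 := by
  rw [c₀_pow_eight]; linear_combination (11664:ℝ) * Real.sq_sqrt (show (0:ℝ) ≤ 3 by norm_num)

/-- `189 < c₀^8` — the sign condition separating `c₀` (`c₀^8 = 189+108√3`) from the real roots of the companion factor `T^8+18T^4-27` (`189-108√3`). [folklore] -/
theorem c₀_pow_eight_gt : 189 < c₀ ^ 8 := by
  rw [c₀_pow_eight]; have := Real.sqrt_pos.mpr (show (0:ℝ) < 3 by norm_num); linarith

/-- FAMILY (constant): the crux with `c₀` replaced by a real parameter `c`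
(`c = 1` is the constant-dropped variant up to `one_mul`). [folklore] -/
def DasGapTwelveScaled (c : ℝ) : Prop :=
  ∀ (r r' : KZ.IntegralRep 1), r.domain = {x | x 0 ∈ Set.Ioo (0:ℝ) 1} →
    Set.EqOn r.integrand (fun x => (x 0) ^ (-(11:ℝ)/12) * (1 - x 0) ^ (-(3:ℝ)/4)) r.domain →
    r'.domain = {x | x 0 ∈ Set.Ioo (0:ℝ) 1} →
    Set.EqOn r'.integrand (fun x => c * (x 0) ^ (-(3:ℝ)/4) * (1 - x 0) ^ (-(3:ℝ)/4)) r'.domain →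
    KZ.Equivalent r r'

/-- ANCHOR: the crux is the member `c = c₀` of the family (definitionally). [folklore] -/
theorem dasGapTwelve_iff_scaled : DasGapTwelve ↔ DasGapTwelveScaled c₀ :=
  Iff.rfl

/-- Pointwise strict comparison of the two Beta kernels on `(0,1)`. [folklore] -/
theorem kernel_lt {t : ℝ} (ht : t ∈ Set.Ioo (0:ℝ) 1) :
    t ^ (-(3:ℝ)/4) * (1 - t) ^ (-(3:ℝ)/4) < t ^ (-(11:ℝ)/12) * (1 - t) ^ (-(3:ℝ)/4) := by
  have h1 : 0 < (1 - t) ^ (-(3:ℝ)/4) := Real.rpow_pos_of_pos (by linarith [ht.2]) _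
  have h2 : t ^ (-(3:ℝ)/4) < t ^ (-(11:ℝ)/12) :=
    Real.rpow_lt_rpow_of_exponent_gt ht.1 ht.2 (by norm_num)
  exact mul_lt_mul_of_pos_right h2 h1

/-- Without the constant the values differ: `B(1/4,1/4) < B(1/12,1/4)` for ANY pinned pair
(integrability is carried by the representations themselves). [folklore] -/
theorem value_lt_value_without_constant (r r' : KZ.IntegralRep 1)
    (hd : r.domain = {x | x 0 ∈ Set.Ioo (0:ℝ) 1})
    (hi : Set.EqOn r.integrand (fun x => (x 0) ^ (-(11:ℝ)/12) * (1 - x 0) ^ (-(3:ℝ)/4)) r.domain)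
    (hd' : r'.domain = {x | x 0 ∈ Set.Ioo (0:ℝ) 1})
    (hi' : Set.EqOn r'.integrand (fun x => (x 0) ^ (-(3:ℝ)/4) * (1 - x 0) ^ (-(3:ℝ)/4)) r'.domain) :
    r'.value < r.value := by
  have hr : IntegrableOn r.integrand unitIoo := by
    have h := r.integrableOn; rw [hd] at h; exact h
  have hr' : IntegrableOn r'.integrand unitIoo := by
    have h := r'.integrableOn; rw [hd'] at h; exact h
  rw [← sub_pos]
  unfold KZ.IntegralRep.value
  rw [hd, hd', ← integral_sub hr hr']
  refine (setIntegral_pos_iff_support_of_nonneg_ae ?_ (hr.sub hr')).mpr ?_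
  · refine ae_restrict_of_forall_mem measurableSet_unitIoo fun x hx => ?_
    have hx1 : x ∈ r.domain := by rw [hd]; exact hx
    have hx2 : x ∈ r'.domain := by rw [hd']; exact hx
    simp only [Pi.zero_apply, Pi.sub_apply]
    rw [hi hx1, hi' hx2]
    exact (sub_pos.mpr (kernel_lt hx)).le
  · have hsupp : Function.support (r.integrand - r'.integrand) ∩ unitIoo = unitIoo := by
      refine Set.inter_eq_right.mpr fun x hx => ?_
      rw [Function.mem_support, Pi.sub_apply]
      have hx1 : x ∈ r.domain := by rw [hd]; exact hx
      have hx2 : x ∈ r'.domain := by rw [hd']; exact hx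
      rw [hi hx1, hi' hx2]
      exact (sub_pos.mpr (kernel_lt hx)).ne'
    rw [hsupp]
    exact volume_unitIoo_pos

/-- **Any proof must use the constant**: with `c₀` dropped, NO pinned pair is KZ-equivalent
(soundness `KZ.Equivalent.value_eq_holds` + `value_lt_value_without_constant`). [folklore] -/
theorem not_equivalent_without_constant (r r' : KZ.IntegralRep 1)
    (hd : r.domain = {x | x 0 ∈ Set.Ioo (0:ℝ) 1})
    (hi : Set.EqOn r.integrand (fun x => (x 0) ^ (-(11:ℝ)/12) * (1 - x 0) ^ (-(3:ℝ)/4)) r.domain)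
    (hd' : r'.domain = {x | x 0 ∈ Set.Ioo (0:ℝ) 1})
    (hi' : Set.EqOn r'.integrand (fun x => (x 0) ^ (-(3:ℝ)/4) * (1 - x 0) ^ (-(3:ℝ)/4)) r'.domain) :
    ¬ KZ.Equivalent r r' := fun h =>
  (value_lt_value_without_constant r r' hd hi hd' hi').ne' (KZ.Equivalent.value_eq_holds h)

/-- A pinned `B(1/12,1/4)` representation has positive value. [folklore] -/
theorem value_pos_of_pinned (r : KZ.IntegralRep 1) (hd : r.domain = {x | x 0 ∈ Set.Ioo (0:ℝ) 1})
    (hi : Set.EqOn r.integrand (fun x => (x 0) ^ (-(11:ℝ)/12) * (1 - x 0) ^ (-(3:ℝ)/4)) r.domain) :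
    0 < r.value := by
  have hr : IntegrableOn r.integrand unitIoo := by
    have h := r.integrableOn; rw [hd] at h; exact h
  have hpos : ∀ x ∈ unitIoo, 0 < r.integrand x := fun x hx => by
    rw [hi (show x ∈ r.domain by rw [hd]; exact hx)]
    exact mul_pos (Real.rpow_pos_of_pos hx.1 _) (Real.rpow_pos_of_pos (sub_pos.2 hx.2) _)
  unfold KZ.IntegralRep.value
  rw [hd]
  refine (setIntegral_pos_iff_support_of_nonneg_ae ?_ hr).mpr ?_
  · exact ae_restrict_of_forall_mem measurableSet_unitIoo fun x hx => (hpos x hx).le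
  · have hsupp : Function.support r.integrand ∩ unitIoo = unitIoo :=
      Set.inter_eq_right.mpr fun x hx => Function.mem_support.mpr (hpos x hx).ne'
    rw [hsupp]
    exact volume_unitIoo_pos

/-- The value of a `c · B(1/4,1/4)`-pinned representation (no integrability needed: junk-safe). [folklore] -/
theorem value_eq_const_mul (r' : KZ.IntegralRep 1) (c : ℝ)
    (hd' : r'.domain = {x | x 0 ∈ Set.Ioo (0:ℝ) 1})
    (hi' : Set.EqOn r'.integrand (fun x => c * (x 0) ^ (-(3:ℝ)/4) * (1 - x 0) ^ (-(3:ℝ)/4))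
      r'.domain) :
    r'.value = c * ∫ x in unitIoo, (x 0) ^ (-(3:ℝ)/4) * (1 - x 0) ^ (-(3:ℝ)/4) := by
  have hi'' : Set.EqOn r'.integrand (fun x => c * ((x 0) ^ (-(3:ℝ)/4) * (1 - x 0) ^ (-(3:ℝ)/4)))
      unitIoo := fun x hx =>
    (hi' (show x ∈ r'.domain by rw [hd']; exact hx)).trans (mul_assoc _ _ _)
  unfold KZ.IntegralRep.value
  rw [hd', setIntegral_congr_fun measurableSet_unitIoo hi'', integral_const_mul]

/-- **Tightness.** If the `B(1/12,1/4)` representation is equivalent both to a `c`-scaled and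
to a `c'`-scaled `B(1/4,1/4)` representation then `c = c'`: the constant of the crux cannot
be altered (in particular not replaced by the real root `2^(-1/4)3^(3/8)√(√3-1) = 1.086…` of the
companion factor `T^8 + 18T^4 - 27` of `(T^8-189)^2-34992`, which the sign-blind equation
`W² = 34992` of `c₀_graph_iff` would otherwise admit). [folklore] -/
theorem constant_unique {c c' : ℝ} (r r₁ r₂ : KZ.IntegralRep 1)
    (hd : r.domain = {x | x 0 ∈ Set.Ioo (0:ℝ) 1})
    (hi : Set.EqOn r.integrand (fun x => (x 0) ^ (-(11:ℝ)/12) * (1 - x 0) ^ (-(3:ℝ)/4)) r.domain)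
    (hd₁ : r₁.domain = {x | x 0 ∈ Set.Ioo (0:ℝ) 1})
    (hi₁ : Set.EqOn r₁.integrand (fun x => c * (x 0) ^ (-(3:ℝ)/4) * (1 - x 0) ^ (-(3:ℝ)/4))
      r₁.domain)
    (hd₂ : r₂.domain = {x | x 0 ∈ Set.Ioo (0:ℝ) 1})
    (hi₂ : Set.EqOn r₂.integrand (fun x => c' * (x 0) ^ (-(3:ℝ)/4) * (1 - x 0) ^ (-(3:ℝ)/4))
      r₂.domain)
    (h₁ : KZ.Equivalent r r₁) (h₂ : KZ.Equivalent r r₂) : c = c' := by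
  have hv₁ : r.value = r₁.value := KZ.Equivalent.value_eq_holds h₁
  have hv₂ : r.value = r₂.value := KZ.Equivalent.value_eq_holds h₂
  rw [value_eq_const_mul r₁ c hd₁ hi₁] at hv₁
  rw [value_eq_const_mul r₂ c' hd₂ hi₂] at hv₂
  have hpos := value_pos_of_pinned r hd hi
  have hI : (∫ x in unitIoo, (x 0) ^ (-(3:ℝ)/4) * (1 - x 0) ^ (-(3:ℝ)/4)) ≠ 0 := fun h0 => by
    rw [h0, mul_zero] at hv₁
    exact hpos.ne' hv₁
  exact mul_right_cancel₀ hI (hv₁.symm.trans hv₂)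

/-- `B(1/4,1/4) < B(1/12,1/4)` in the form needed: the bare kernel integral is below the value of
ANY pinned `B(1/12,1/4)` representation (integrability of the kernel from the witness construction,
of `r` from `r` itself). [folklore] -/
theorem kernelIntegral_lt_value (r : KZ.IntegralRep 1) (hd : r.domain = {x | x 0 ∈ Set.Ioo (0:ℝ) 1})
    (hi : Set.EqOn r.integrand (fun x => (x 0) ^ (-(11:ℝ)/12) * (1 - x 0) ^ (-(3:ℝ)/4)) r.domain) :
    (∫ x in unitIoo, (x 0) ^ (-(3:ℝ)/4) * (1 - x 0) ^ (-(3:ℝ)/4)) < r.value := by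
  have hr : IntegrableOn r.integrand unitIoo := by
    have h := r.integrableOn; rw [hd] at h; exact h
  have hg : IntegrableOn (fun x : Fin 1 → ℝ => (x 0) ^ (-(3:ℝ)/4) * (1 - x 0) ^ (-(3:ℝ)/4)) unitIoo :=
    integrableOn_rpow_mul_rpow (by norm_num) (by norm_num)
  rw [← sub_pos]
  unfold KZ.IntegralRep.value
  rw [hd, ← integral_sub hr hg]
  refine (setIntegral_pos_iff_support_of_nonneg_ae ?_ (hr.sub hg)).mpr ?_
  · refine ae_restrict_of_forall_mem measurableSet_unitIoo fun x hx => ?_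
    have hx1 : x ∈ r.domain := by rw [hd]; exact hx
    simp only [Pi.zero_apply, Pi.sub_apply]
    rw [hi hx1]
    exact (sub_pos.mpr (kernel_lt hx)).le
  · have hsupp : Function.support (r.integrand - fun x : Fin 1 → ℝ =>
        (x 0) ^ (-(3:ℝ)/4) * (1 - x 0) ^ (-(3:ℝ)/4)) ∩ unitIoo = unitIoo := by
      refine Set.inter_eq_right.mpr fun x hx => ?_
      rw [Function.mem_support, Pi.sub_apply]
      have hx1 : x ∈ r.domain := by rw [hd]; exact hx
      rw [hi hx1]
      exact (sub_pos.mpr (kernel_lt hx)).ne'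
    rw [hsupp]
    exact volume_unitIoo_pos

/-- The bare kernel integral is nonnegative. [folklore] -/
theorem kernelIntegral_nonneg :
    0 ≤ ∫ x in unitIoo, (x 0) ^ (-(3:ℝ)/4) * (1 - x 0) ^ (-(3:ℝ)/4) :=
  setIntegral_nonneg measurableSet_unitIoo fun _ hx =>
    (mul_pos (Real.rpow_pos_of_pos hx.1 _) (Real.rpow_pos_of_pos (sub_pos.2 hx.2) _)).le

/-- **Load-bearing (constant), universal form.** For every real `c ≤ 1` NO pinned pair of the
family is equivalent: `value r' = c·∫kernel ≤ ∫kernel < value r`. In particular dropping `c₀`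
(`c = 1`), zeroing it or flipping its sign kills the statement; the chain must create `c₀ > 1`. [folklore] -/
theorem not_equivalent_of_le_one {c : ℝ} (hc : c ≤ 1) (r r' : KZ.IntegralRep 1)
    (hd : r.domain = {x | x 0 ∈ Set.Ioo (0:ℝ) 1})
    (hi : Set.EqOn r.integrand (fun x => (x 0) ^ (-(11:ℝ)/12) * (1 - x 0) ^ (-(3:ℝ)/4)) r.domain)
    (hd' : r'.domain = {x | x 0 ∈ Set.Ioo (0:ℝ) 1})
    (hi' : Set.EqOn r'.integrand (fun x => c * (x 0) ^ (-(3:ℝ)/4) * (1 - x 0) ^ (-(3:ℝ)/4))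
      r'.domain) :
    ¬ KZ.Equivalent r r' := fun h => by
  have hv : r.value = r'.value := KZ.Equivalent.value_eq_holds h
  rw [value_eq_const_mul r' c hd' hi'] at hv
  have h1 := kernelIntegral_lt_value r hd hi
  have h2 := mul_le_of_le_one_left kernelIntegral_nonneg hc
  linarith

/-- `c₀` is algebraic over `ℚ`: a root of `(T^8 - 189)^2 - 34992`. [folklore] -/
theorem isAlgebraic_c₀ : IsAlgebraic ℚ c₀ := by
  refine ⟨(Polynomial.X ^ 8 - Polynomial.C 189) ^ 2 - Polynomial.C 34992, ?_, ?_⟩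
  · intro h
    have h0 := congrArg (Polynomial.eval 0) h
    simp only [Polynomial.eval_sub, Polynomial.eval_pow, Polynomial.eval_X, Polynomial.eval_C,
      Polynomial.eval_zero] at h0
    norm_num at h0
  · simp only [map_sub, map_pow, Polynomial.aeval_X, Polynomial.aeval_C, eq_ratCast]
    rw [show ((189:ℚ):ℝ) = 189 by norm_num, show ((34992:ℚ):ℝ) = 34992 by norm_num,
      c₀_pow_eight_sub_sq, sub_self]

/-- The Deligne–Koblitz–Ogus Hodge-type condition of the pair `(1/12,1/4 ; 1/4,1/4)`, weight `0`,
for every `u` coprime to `12` (reduction to `u mod 12 ∈ {1,5,7,11}`). [folklore] -/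
theorem hodge_condition (u : ℕ) (hu : Nat.Coprime u 12) :
    Int.fract ((u:ℚ) * (1/12)) + Int.fract ((u:ℚ) * (1/4)) - Int.fract ((u:ℚ) * (1/12 + 1/4))
      - (Int.fract ((u:ℚ) * (1/4)) + Int.fract ((u:ℚ) * (1/4)) - Int.fract ((u:ℚ) * (1/4 + 1/4)))
      = 0 := by
  have h2 : ¬ 2 ∣ u := by
    have h := Nat.Coprime.coprime_dvd_right (show 2 ∣ 12 by norm_num) hu
    rwa [Nat.coprime_comm, Nat.prime_two.coprime_iff_not_dvd] at h
  have h3 : ¬ 3 ∣ u := by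
    have h := Nat.Coprime.coprime_dvd_right (show 3 ∣ 12 by norm_num) hu
    rwa [Nat.coprime_comm, Nat.prime_three.coprime_iff_not_dvd] at h
  rw [show (u:ℚ) * (1/12) = (u:ℚ) / ((12:ℕ):ℚ) by push_cast; ring,
    show (u:ℚ) * (1/4) = (u:ℚ) / ((4:ℕ):ℚ) by push_cast; ring,
    show (u:ℚ) * (1/12 + 1/4) = (u:ℚ) / ((3:ℕ):ℚ) by push_cast; ring,
    show (u:ℚ) * (1/4 + 1/4) = (u:ℚ) / ((2:ℕ):ℚ) by push_cast; ring]
  simp only [Int.fract_div_natCast_eq_div_natCast_mod]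
  have h12 : u % 12 = 1 ∨ u % 12 = 5 ∨ u % 12 = 7 ∨ u % 12 = 11 := by omega
  rcases h12 with h | h | h | h
  · rw [h, show u % 4 = 1 by omega, show u % 3 = 1 by omega, show u % 2 = 1 by omega]
    push_cast; norm_num
  · rw [h, show u % 4 = 1 by omega, show u % 3 = 2 by omega, show u % 2 = 1 by omega]
    push_cast; norm_num
  · rw [h, show u % 4 = 3 by omega, show u % 3 = 1 by omega, show u % 2 = 1 by omega]
    push_cast; norm_num
  · rw [h, show u % 4 = 3 by omega, show u % 3 = 2 by omega, show u % 2 = 1 by omega]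
    push_cast; norm_num

/-- `c₀ ∉ ℚ` (else `√3 = (c₀^8 - 189)/108` would be rational). [folklore] -/
theorem irrational_c₀ : Irrational c₀ := by
  intro ⟨q, hq⟩
  have h3 : Irrational (Real.sqrt 3) := by
    simpa using Nat.Prime.irrational_sqrt (p := 3) Nat.prime_three
  apply h3
  refine ⟨(q ^ 8 - 189) / 108, ?_⟩
  have h := c₀_pow_eight
  rw [← hq] at h
  push_cast
  linarith

end Summit.KontsevichZagierPeriods.TerasomaMultiplication.DasGapTwelveNegative
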